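import Literature.Computability.QuantumComplexity.JonesDigestClosedForm
import Literature.Computability.QuantumComplexity.StrandCompressClosedForm
import Literature.Computability.QuantumComplexity.JonesPostFP
import Literature.Computability.QuantumComplexity.PromiseBQPOverTransport
import Literature.Computability.Complexity.ListFoldBricks
import Literature.Computability.Complexity.ListBricks
import Literature.Computability.Complexity.FoldCatBricks
import HarnessLib

/-!
# A polynomial-time digest for the AJL family

Topic `Literature/Computability/QuantumComplexity`; a step in the discharge of
`ajl_jonesApproxProblem_mem_PromiseBQP` (and, through `PromiseBQPOverTransport.lean`, of
`ajl_mem_PromiseBQPOver_ajlGateSet`): the classical pre-processor of Algorithm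
Approximate-Jones-Plat-Closure (Aharonov–Jones–Landau, arXiv:quant-ph/0511096 = Algorithmica 55
(2009), §3.3: the braid word is read and laid out for the circuit) as a string function of the tree's
`FP` algebra agreeing with `AJLCore.digest` (`JonesDigest.lean`) on the encodings of valid instances,
which is what `AJLCore.mem_PromiseBQP_of_uniform_of_digest'` (`JonesPostFP.lean`) consumes. The
target string is the block form `digest_encode_eq_blocks` (`JonesDigestClosedForm.lean`) with the
compressed word in closed form (`StrandCompressClosedForm.lean`: renumber the touched strand pairs by
rank). Stages:

1. the list of distinct touched pairs `⌊j/2⌋, ⌊(j+1)/2⌋` of the letters (`dgTouchedF`, a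
   `Brick.foldFn` with a membership test by value);
2. the renumbered letters `σ_j^{±} ↦ σ_{2·rank ⌊j/2⌋ + j mod 2}^{±}` (`dgRenumF`, a `Brick.mapLF` whose
   item function counts the touched pairs below `⌊j/2⌋` by a second fold);
3. the one-hot table of the renumbered letters (`dgTableF`, a fold concatenating blocks), the
   pattern `(0001)^t 00` of `|α⟩` and the zero padding to `16 t²` (`dgDigestF`).

Main results: `dgDigestF_mem_FP`, **`dgDigestF_encode`** (`dgDigestF (encode x) = digest (encode x)`
for valid `x`), and **`mem_PromiseBQP_of_uniform`**:
`AJLCore.family.IsUniform → ajl_jonesApproxProblem_mem_PromiseBQP` — of the hypotheses of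
`JonesPost.mem_PromiseBQP_of_FP` only the uniformity of the core family remains.

## References

* D. Aharonov, V. Jones, Z. Landau, *A polynomial quantum algorithm for approximating the Jones
  polynomial*, Algorithmica 55 (2009) = arXiv:quant-ph/0511096, §3.3, Thm. 1.2
  [AharonovJonesLandau2009].
* S. Arora, B. Barak, *Computational Complexity: A Modern Approach*, CUP 2009, §1.3 (polynomial
  time is closed under composition and bounded loops) [AroraBarak2009].
-/

noncomputable section

namespace Literature.Computability.QuantumComplexity

open _root_.Computability Cryptography Complexity Complexity.Brick BlockKit

namespace AJLCore

/-! ### The mathematical model: distinct touched pairs by insertion, ranks by counting -/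

/-- Insert a value into a list unless it is already there. [folklore] -/
def insVal (u : ℕ) (D : List ℕ) : List ℕ := if u ∈ D then D else u :: D

/-- Insert the two pairs touched by the letter `σ_j`. [folklore] -/
def insLetter (D : List ℕ) (j : ℕ) : List ℕ := insVal ((j + 1) / 2) (insVal (j / 2) D)

/-- The list of distinct touched pairs of a list of generator indices, by successive insertion from
an initial list. [folklore] -/
def touchedListFrom (D : List ℕ) (js : List ℕ) : List ℕ := js.foldl insLetter D

/-- `insVal` keeps `Nodup`. [folklore] -/
theorem nodup_insVal {u : ℕ} {D : List ℕ} (h : D.Nodup) : (insVal u D).Nodup := by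
  unfold insVal; split_ifs with hu
  · exact h
  · exact List.nodup_cons.2 ⟨hu, h⟩

/-- Members of `insVal`. [folklore] -/
theorem mem_insVal {u v : ℕ} {D : List ℕ} : v ∈ insVal u D ↔ v = u ∨ v ∈ D := by
  unfold insVal; split_ifs with hu
  · exact ⟨Or.inr, fun h => h.elim (fun e => e ▸ hu) id⟩
  · exact List.mem_cons

/-- The insertion fold keeps `Nodup`. [folklore] -/
theorem nodup_touchedListFrom : ∀ (js : List ℕ) {D : List ℕ}, D.Nodup → (touchedListFrom D js).Nodup
  | [], _, h => h
  | _ :: js, _, h => nodup_touchedListFrom js (nodup_insVal (nodup_insVal h))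

/-- Members of the insertion fold: the initial values and the touched pairs. [folklore] -/
theorem mem_touchedListFrom : ∀ (js : List ℕ) {D : List ℕ} {v : ℕ},
    v ∈ touchedListFrom D js ↔ v ∈ D ∨ ∃ j ∈ js, v = j / 2 ∨ v = (j + 1) / 2
  | [], D, v => by simp [touchedListFrom]
  | j :: js, D, v => by
    rw [touchedListFrom, List.foldl_cons, ← touchedListFrom, mem_touchedListFrom js, insLetter, mem_insVal, mem_insVal]
    constructor
    · rintro ((h | h | h) | ⟨j', hj', h⟩)
      · exact Or.inr ⟨j, by simp, Or.inr h⟩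
      · exact Or.inr ⟨j, by simp, Or.inl h⟩
      · exact Or.inl h
      · exact Or.inr ⟨j', by simp [hj'], h⟩
    · rintro (h | ⟨j', hj', h⟩)
      · exact Or.inl (Or.inr (Or.inr h))
      · rcases List.mem_cons.1 hj' with rfl | hj'
        · rcases h with h | h
          · exact Or.inl (Or.inr (Or.inl h))
          · exact Or.inl (Or.inl h)
        · exact Or.inr ⟨j', hj', h⟩

/-- **The insertion fold lists the touched pairs** (`StrandCompressClosedForm.touched`). [folklore] -/
theorem toFinset_touchedListFrom (w : List (ℕ × Bool)) : (touchedListFrom [] (w.map Prod.fst)).toFinset = touched w := by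
  ext v
  rw [List.mem_toFinset, mem_touchedListFrom, mem_touched]
  simp only [List.not_mem_nil, false_or, List.mem_map]
  constructor
  · rintro ⟨_, ⟨g, hg, rfl⟩, h⟩; exact ⟨g, hg, h.elim (fun e => Or.inl e.symm) fun e => Or.inr e.symm⟩
  · rintro ⟨g, hg, h⟩; exact ⟨g.1, ⟨g, hg, rfl⟩, h.elim (fun e => Or.inl e.symm) fun e => Or.inr e.symm⟩

/-- **Ranks by counting**: `rank w p` is the number of entries below `p` of the insertion fold.
[folklore] -/
theorem rank_eq_length_filter (w : List (ℕ × Bool)) (p : ℕ) :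
    rank w p = ((touchedListFrom [] (w.map Prod.fst)).filter (· < p)).length := by
  rw [rank, ← toFinset_touchedListFrom,
    ← List.toFinset_card_of_nodup ((nodup_touchedListFrom (w.map Prod.fst) List.nodup_nil).filter fun u => decide (u < p))]
  congr 1
  ext u
  simp

/-- The count of entries below `p`, as a left fold. [folklore] -/
theorem foldl_count_lt (p : ℕ) : ∀ (D : List ℕ) (c : ℕ),
    D.foldl (fun c u => if u < p then c + 1 else c) c = c + (D.filter (· < p)).length
  | [], c => by simp
  | u :: D, c => by
    rw [List.foldl_cons, foldl_count_lt p D, List.filter_cons]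
    by_cases h : u < p
    · rw [if_pos h]; simp [h]; omega
    · rw [if_neg h]; simp [h]

/-! ### Stage 1: the distinct touched pairs -/

/-- Membership by value: `⟨q, L⟩ ↦ [some item of L has the value ⟦q⟧]`. [folklore] -/
def dgMemValF : List Bool → List Bool := anyFn eqValFn

/-- `dgMemValF ∈ FP`. [folklore] -/
theorem dgMemValF_mem_FP : dgMemValF ∈ FP := anyFn_mem_FP eqValFn_mem_FP oneBit_eqValFn

/-- `dgMemValF` is one-bit. [folklore] -/
theorem oneBit_dgMemValF : OneBit dgMemValF := oneBit_anyFn oneBit_eqValFn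

/-- Value of the membership test on a coded list of numerals. [folklore] -/
theorem dgMemValF_apply (u : ℕ) (D : List ℕ) :
    dgMemValF (boolPair (encodeNat u) (encList (D.map encodeNat))) = [decide (u ∈ D)] := by
  rw [dgMemValF, anyFn_boolPair oneBit_eqValFn, decNil_encList]
  congr 1
  rw [Bool.eq_iff_iff]
  simp only [decide_eq_true_eq]
  constructor
  · rintro ⟨_, ha, h'⟩
    obtain ⟨v, hv, rfl⟩ := List.mem_map.1 ha
    rw [eqValFn_boolPair, bitsToNat_encodeNat, bitsToNat_encodeNat] at h'
    have e : u = v := by simpa using h'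
    exact e ▸ hv
  · intro h
    exact ⟨encodeNat u, List.mem_map.2 ⟨u, h, rfl⟩, by rw [eqValFn_boolPair]; simp⟩

/-- Insertion unless present: `⟨u, L⟩ ↦ L` if `⟦u⟧` occurs in `L`, else `⟨u, L⟩` itself (which is the
code of `u :: L`). [folklore] -/
def dgInsF : List Bool → List Bool := iteFn dgMemValF sndF id

/-- `dgInsF ∈ FP`. [folklore] -/
theorem dgInsF_mem_FP : dgInsF ∈ FP := iteFn_mem_FP dgMemValF_mem_FP sndF_mem_FP (PolyTimeComputable.id _)

/-- `dgInsF` never lengthens its input. [folklore] -/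
theorem length_dgInsF_le (z : List Bool) : (dgInsF z).length ≤ z.length := by
  rw [dgInsF, iteFn_of_oneBit oneBit_dgMemValF]
  split_ifs
  · have := length_fstF_sndF_le z; omega
  · exact le_rfl

/-- Value of `dgInsF` on coded data: `insVal`. [folklore] -/
theorem dgInsF_apply (u : ℕ) (D : List ℕ) :
    dgInsF (boolPair (encodeNat u) (encList (D.map encodeNat))) = encList ((insVal u D).map encodeNat) := by
  rw [dgInsF, iteFn_apply (dgMemValF_apply u D), insVal]
  by_cases h : u ∈ D
  · rw [decide_eq_true h, if_pos rfl, if_pos h, sndF_boolPair]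
  · rw [decide_eq_false h, if_neg h, List.map_cons, encList_cons]; rfl

/-- The numeral of the letter of a fold step `⟨w, ⟨item, acc⟩⟩` (first field of the item). [folklore] -/
def dgStepJF : List Bool → List Bool := fstF ∘ nthF 1

/-- `bin ⌊j/2⌋` of the step's letter. [folklore] -/
def dgHalfF : List Bool → List Bool := divFn ∘ fanoutFn dgStepJF (fun _ => encodeNat 2)

/-- `bin ⌊(j+1)/2⌋` of the step's letter. [folklore] -/
def dgHalfSuccF : List Bool → List Bool :=
  divFn ∘ fanoutFn (addFn ∘ fanoutFn dgStepJF (fun _ => encodeNat 1)) (fun _ => encodeNat 2)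

/-- **The step of stage 1**: insert `⌊j/2⌋`, then `⌊(j+1)/2⌋`, into the accumulator. [folklore] -/
def dgTouchStep : List Bool → List Bool :=
  dgInsF ∘ fanoutFn dgHalfSuccF (dgInsF ∘ fanoutFn dgHalfF (sndPow 1))

/-- `dgStepJF ∈ FP`. [folklore] -/
theorem dgStepJF_mem_FP : dgStepJF ∈ FP := comp_mem_FP fstF_mem_FP (nthF_mem_FP 1)

/-- `dgHalfF ∈ FP`. [folklore] -/
theorem dgHalfF_mem_FP : dgHalfF ∈ FP := comp_mem_FP divFn_mem_FP (fanoutFn_mem_FP dgStepJF_mem_FP (const_mem_FP _))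

/-- `dgHalfSuccF ∈ FP`. [folklore] -/
theorem dgHalfSuccF_mem_FP : dgHalfSuccF ∈ FP :=
  comp_mem_FP divFn_mem_FP (fanoutFn_mem_FP (comp_mem_FP addFn_mem_FP (fanoutFn_mem_FP dgStepJF_mem_FP (const_mem_FP _)))
    (const_mem_FP _))

/-- `dgTouchStep ∈ FP`. [folklore] -/
theorem dgTouchStep_mem_FP : dgTouchStep ∈ FP :=
  comp_mem_FP dgInsF_mem_FP (fanoutFn_mem_FP dgHalfSuccF_mem_FP
    (comp_mem_FP dgInsF_mem_FP (fanoutFn_mem_FP dgHalfF_mem_FP (sndPow_mem_FP 1))))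

/-- `|bin 2| = 2`. [folklore] -/
theorem bitsToNat_encodeNat_two : bitsToNat (encodeNat 2) = 2 := bitsToNat_encodeNat 2

/-- Value of `dgHalfF`. [folklore] -/
theorem dgHalfF_apply (v : List Bool) : dgHalfF v = encodeNat (bitsToNat (dgStepJF v) / 2) := by
  simp [dgHalfF]

/-- Value of `dgHalfSuccF`. [folklore] -/
theorem dgHalfSuccF_apply (v : List Bool) : dgHalfSuccF v = encodeNat ((bitsToNat (dgStepJF v) + 1) / 2) := by
  simp [dgHalfSuccF]

/-- `|bin ⌊j/2⌋|, |bin ⌊(j+1)/2⌋| ≤ |J|` for the numeral `J` read. [folklore] -/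
theorem length_dgHalf_le (v : List Bool) :
    (dgHalfF v).length ≤ (dgStepJF v).length ∧ (dgHalfSuccF v).length ≤ (dgStepJF v).length := by
  rw [dgHalfF_apply, dgHalfSuccF_apply]
  have h0 := length_encodeNat_bitsToNat_le (dgStepJF v)
  refine ⟨(length_encodeNat_mono (Nat.div_le_self _ _)).trans h0, (length_encodeNat_mono ?_).trans h0⟩
  have : bitsToNat (dgStepJF v) = 0 ∨ 1 ≤ bitsToNat (dgStepJF v) := by omega
  rcases this with h | h <;> omega

/-- **Growth of the stage-1 step.** [folklore] -/
theorem foldGrowth_dgTouchStep : FoldGrowth 4 dgTouchStep := by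
  intro v
  obtain ⟨h1, h2⟩ := length_dgHalf_le v
  have hJ : (dgStepJF v).length ≤ (fstF (sndF v)).length := by
    simp only [dgStepJF, nthF, Function.comp_apply]
    have := length_fstF_sndF_le (fstF (sndF v)); omega
  have hacc : (sndPow 1 v).length = (sndF (sndF v)).length := by simp [sndPow]
  simp only [dgTouchStep, Function.comp_apply, fanoutFn_apply]
  refine (length_dgInsF_le _).trans ?_
  rw [length_boolPair]
  have h3 := length_dgInsF_le (boolPair (dgHalfF v) (sndPow 1 v))
  rw [length_boolPair] at h3
  nlinarith

/-- **Value of the stage-1 step on coded data**: `insLetter`. [folklore] -/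
theorem dgTouchStep_apply (w : List Bool) (j : ℕ) (s : List Bool) (D : List ℕ) :
    dgTouchStep (boolPair w (boolPair (boolPair (encodeNat j) s) (encList (D.map encodeNat)))) =
      encList ((insLetter D j).map encodeNat) := by
  have hJ : dgStepJF (boolPair w (boolPair (boolPair (encodeNat j) s) (encList (D.map encodeNat)))) = encodeNat j := by
    simp [dgStepJF]
  simp only [dgTouchStep, Function.comp_apply, fanoutFn_apply, dgHalfF_apply, dgHalfSuccF_apply, hJ, bitsToNat_encodeNat,
    sndPow_succ_boolPair, sndPow_zero_boolPair, dgInsF_apply]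
  rfl

/-- **Stage 1**: the coded list of distinct touched pairs, `⟨x, L⟩ ↦ encList (touchedListFrom [] js)`
for a coded letter list `L`. [folklore] -/
def dgTouchedF : List Bool → List Bool := foldFn dgTouchStep fun _ => []

/-- `dgTouchedF ∈ FP`. [folklore] -/
theorem dgTouchedF_mem_FP : dgTouchedF ∈ FP := foldFn_mem_FP dgTouchStep_mem_FP (const_mem_FP _) foldGrowth_dgTouchStep

/-- The code of a letter `σ_j^{σ}` in an instance: `⟨bin j, [σ]⟩`. [folklore] -/
def letterCode (g : ℕ × Bool) : List Bool := boolPair (encodeNat g.1) [g.2]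

/-- **Value of stage 1** on `⟨x, encList (letter codes)⟩`. [folklore] -/
theorem dgTouchedF_apply (x : List Bool) (w : List (ℕ × Bool)) :
    dgTouchedF (boolPair x (encList (w.map letterCode))) = encList ((touchedListFrom [] (w.map Prod.fst)).map encodeNat) := by
  rw [dgTouchedF, foldFn_boolPair, decNil_encList]
  suffices h : ∀ (l : List (ℕ × Bool)) (D : List ℕ),
      (l.map letterCode).foldl (fun acc a => dgTouchStep (boolPair (boolPair x (encList (w.map letterCode))) (boolPair a acc)))
        (encList (D.map encodeNat)) = encList ((touchedListFrom D (l.map Prod.fst)).map encodeNat) by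
    simpa using h w []
  intro l
  induction l with
  | nil => intro D; rfl
  | cons g l ih =>
    intro D
    rw [List.map_cons, List.foldl_cons, letterCode, dgTouchStep_apply, ih]
    rfl

/-! ### Stage 2: renumbering the letters -/

/-- The counting step `⟨⟨P, _⟩, ⟨a, acc⟩⟩ ↦ acc + [⟦a⟧ < ⟦P⟧]`. [folklore] -/
def dgCountStep : List Bool → List Bool :=
  iteFn (ltFn ∘ fanoutFn (fstF ∘ sndF) (fstF ∘ fstF)) (addFn ∘ fanoutFn (sndPow 1) fun _ => encodeNat 1) (sndPow 1)

/-- `dgCountStep ∈ FP`. [folklore] -/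
theorem dgCountStep_mem_FP : dgCountStep ∈ FP :=
  iteFn_mem_FP (comp_mem_FP ltFn_mem_FP (fanoutFn_mem_FP (comp_mem_FP fstF_mem_FP sndF_mem_FP) (comp_mem_FP fstF_mem_FP fstF_mem_FP)))
    (comp_mem_FP addFn_mem_FP (fanoutFn_mem_FP (sndPow_mem_FP 1) (const_mem_FP _))) (sndPow_mem_FP 1)

/-- Growth of the counting step. [folklore] -/
theorem foldGrowth_dgCountStep : FoldGrowth 1 dgCountStep := by
  intro v
  have hc : (ltFn ∘ fanoutFn (fstF ∘ sndF) (fstF ∘ fstF)) v = [decide (bitsToNat (fstF (sndF v)) < bitsToNat (fstF (fstF v)))] := by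
    simp
  rw [dgCountStep, iteFn_apply hc]
  have hacc : (sndPow 1 v).length = (sndF (sndF v)).length := by simp [sndPow]
  split_ifs
  · simp only [Function.comp_apply, fanoutFn_apply, addFn_boolPair, bitsToNat_encodeNat]
    have h1 := length_encodeNat_succ_le (bitsToNat (sndPow 1 v))
    have h2 := length_encodeNat_bitsToNat_le (sndPow 1 v)
    omega
  · omega

/-- Value of the counting step on coded data. [folklore] -/
theorem dgCountStep_apply (p : ℕ) (L : List Bool) (u c : ℕ) :
    dgCountStep (boolPair (boolPair (encodeNat p) L) (boolPair (encodeNat u) (encodeNat c))) =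
      encodeNat (if u < p then c + 1 else c) := by
  have hc : (ltFn ∘ fanoutFn (fstF ∘ sndF) (fstF ∘ fstF)) (boolPair (boolPair (encodeNat p) L) (boolPair (encodeNat u) (encodeNat c))) =
      [decide (u < p)] := by simp
  rw [dgCountStep, iteFn_apply hc]
  by_cases h : u < p
  · rw [decide_eq_true h, if_pos rfl, if_pos h]; simp
  · rw [decide_eq_false h, if_neg h]; simp

/-- **Counting the items below a value**: `⟨P, encList D⟩ ↦ bin #{u ∈ D | u < ⟦P⟧}`. [folklore] -/
def dgCountBelowF : List Bool → List Bool := foldFn dgCountStep fun _ => encodeNat 0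

/-- `dgCountBelowF ∈ FP`. [folklore] -/
theorem dgCountBelowF_mem_FP : dgCountBelowF ∈ FP := foldFn_mem_FP dgCountStep_mem_FP (const_mem_FP _) foldGrowth_dgCountStep

/-- **Value of the count.** [folklore] -/
theorem dgCountBelowF_apply (p : ℕ) (D : List ℕ) :
    dgCountBelowF (boolPair (encodeNat p) (encList (D.map encodeNat))) = encodeNat (D.filter (· < p)).length := by
  rw [dgCountBelowF, foldFn_boolPair, decNil_encList]
  suffices h : ∀ (l : List ℕ) (c : ℕ),
      (l.map encodeNat).foldl (fun acc a => dgCountStep (boolPair (boolPair (encodeNat p) (encList (D.map encodeNat))) (boolPair a acc)))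
        (encodeNat c) = encodeNat (c + (l.filter (· < p)).length) by
    simpa using h D 0
  intro l
  induction l with
  | nil => intro c; simp
  | cons u l ih =>
    intro c
    rw [List.map_cons, List.foldl_cons, dgCountStep_apply, ih, List.filter_cons]
    by_cases h : u < p
    · rw [if_pos h]; simp [h]; ring_nf
    · rw [if_neg h]; simp [h]

/-- In a stage-2 item record `⟨x, ⟨Dc, ⟨bin j, s⟩⟩⟩`: the numeral `bin j`. [folklore] -/
def dgItJF : List Bool → List Bool := fstF ∘ sndPow 1

/-- `bin ⌊j/2⌋`. [folklore] -/
def dgItPF : List Bool → List Bool := divFn ∘ fanoutFn dgItJF fun _ => encodeNat 2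

/-- `bin #{u ∈ D | u < ⌊j/2⌋}`. [folklore] -/
def dgItRankF : List Bool → List Bool := dgCountBelowF ∘ fanoutFn dgItPF (nthF 1)

/-- `bin (2·rank + j mod 2)`. [folklore] -/
def dgItIdxF : List Bool → List Bool :=
  addFn ∘ fanoutFn (prodFn ∘ fanoutFn (fun _ => encodeNat 2) dgItRankF) (remFn ∘ fanoutFn dgItJF fun _ => encodeNat 2)

/-- The item function of stage 2 on `⟨x, ⟨Dc, item⟩⟩`: the renumbered letter code
`⟨bin (2·#{u ∈ D | u < ⌊j/2⌋} + j mod 2), σ-field⟩`. [folklore] -/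
def dgRenumItemF : List Bool → List Bool := fanoutFn dgItIdxF (sndF ∘ sndPow 1)

/-- `dgItJF ∈ FP`. [folklore] -/
theorem dgItJF_mem_FP : dgItJF ∈ FP := comp_mem_FP fstF_mem_FP (sndPow_mem_FP 1)

/-- `dgItPF ∈ FP`. [folklore] -/
theorem dgItPF_mem_FP : dgItPF ∈ FP := comp_mem_FP divFn_mem_FP (fanoutFn_mem_FP dgItJF_mem_FP (const_mem_FP _))

/-- `dgItRankF ∈ FP`. [folklore] -/
theorem dgItRankF_mem_FP : dgItRankF ∈ FP := comp_mem_FP dgCountBelowF_mem_FP (fanoutFn_mem_FP dgItPF_mem_FP (nthF_mem_FP 1))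

/-- `dgItIdxF ∈ FP`. [folklore] -/
theorem dgItIdxF_mem_FP : dgItIdxF ∈ FP :=
  comp_mem_FP addFn_mem_FP (fanoutFn_mem_FP (comp_mem_FP prodFn_mem_FP (fanoutFn_mem_FP (const_mem_FP _) dgItRankF_mem_FP))
    (comp_mem_FP remFn_mem_FP (fanoutFn_mem_FP dgItJF_mem_FP (const_mem_FP _))))

/-- `dgRenumItemF ∈ FP`. [folklore] -/
theorem dgRenumItemF_mem_FP : dgRenumItemF ∈ FP :=
  fanoutFn_mem_FP dgItIdxF_mem_FP (comp_mem_FP sndF_mem_FP (sndPow_mem_FP 1))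

section ItemValues

variable (x : List Bool) (D : List ℕ) (j : ℕ) (s : List Bool)

/-- Value of `dgItJF`. [folklore] -/
theorem dgItJF_apply : dgItJF (boolPair x (boolPair (encList (D.map encodeNat)) (boolPair (encodeNat j) s))) = encodeNat j := by
  simp [dgItJF]

/-- Value of `dgItPF`. [folklore] -/
theorem dgItPF_apply : dgItPF (boolPair x (boolPair (encList (D.map encodeNat)) (boolPair (encodeNat j) s))) = encodeNat (j / 2) := by
  rw [dgItPF, Function.comp_apply, fanoutFn_apply, dgItJF_apply, divFn_boolPair, bitsToNat_encodeNat, bitsToNat_encodeNat]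

/-- Value of `dgItRankF`. [folklore] -/
theorem dgItRankF_apply :
    dgItRankF (boolPair x (boolPair (encList (D.map encodeNat)) (boolPair (encodeNat j) s))) =
      encodeNat (D.filter (· < j / 2)).length := by
  rw [dgItRankF, Function.comp_apply, fanoutFn_apply, dgItPF_apply, nthF_succ_boolPair, nthF_zero_boolPair, dgCountBelowF_apply]

/-- Value of `dgItIdxF`. [folklore] -/
theorem dgItIdxF_apply :
    dgItIdxF (boolPair x (boolPair (encList (D.map encodeNat)) (boolPair (encodeNat j) s))) =
      encodeNat (2 * (D.filter (· < j / 2)).length + j % 2) := by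
  rw [dgItIdxF, Function.comp_apply, fanoutFn_apply, Function.comp_apply, fanoutFn_apply, dgItRankF_apply,
    Function.comp_apply, fanoutFn_apply, dgItJF_apply, prodFn_boolPair, remFn_boolPair, addFn_boolPair,
    bitsToNat_encodeNat, bitsToNat_encodeNat, bitsToNat_encodeNat, bitsToNat_encodeNat, bitsToNat_encodeNat]

/-- **Value of the stage-2 item function** on `⟨x, ⟨encList D, ⟨bin j, s⟩⟩⟩`. [folklore] -/
theorem dgRenumItemF_apply :
    dgRenumItemF (boolPair x (boolPair (encList (D.map encodeNat)) (boolPair (encodeNat j) s))) =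
      boolPair (encodeNat (2 * (D.filter (· < j / 2)).length + j % 2)) s := by
  rw [dgRenumItemF, fanoutFn_apply, dgItIdxF_apply]
  simp

end ItemValues

/-- The clipped item function (output clipped to `|x| + 4` symbols, inactive on instance data; the
clip makes the growth hypothesis of `mapLF_mem_FP` hold on every input). [folklore] -/
def dgRenumItemC : List Bool → List Bool := pclipF (Polynomial.X + 4) dgRenumItemF

/-- `dgRenumItemC ∈ FP`. [folklore] -/
theorem dgRenumItemC_mem_FP : dgRenumItemC ∈ FP := pclipF_mem_FP _ dgRenumItemF_mem_FP

/-- Growth of the clipped item function: `≤ 0·|a| + (|x| + 4)`. [folklore] -/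
theorem length_dgRenumItemC_le (x p a : List Bool) :
    (dgRenumItemC (boolPair x (boolPair p a))).length ≤ 0 * a.length + (Polynomial.X + 4).eval x.length := by
  rw [dgRenumItemC, pclipF_apply, fstF_boolPair, zero_mul, zero_add]
  exact List.length_take_le _ _

/-- **Stage 2**: `⟨x, ⟨bin m, ⟨Dc, L⟩⟩⟩ ↦` the coded list of renumbered letter codes. [folklore] -/
def dgRenumF : List Bool → List Bool := mapLF dgRenumItemC

/-- `dgRenumF ∈ FP`. [folklore] -/
theorem dgRenumF_mem_FP : dgRenumF ∈ FP := mapLF_mem_FP dgRenumItemC_mem_FP (w := 0) (by norm_num) length_dgRenumItemC_le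

/-- The renumbered letter by counting (equal to `renum` on instance data, `renumCount_eq`). [folklore] -/
def renumCount (D : List ℕ) (j : ℕ) : ℕ := 2 * (D.filter (· < j / 2)).length + j % 2

/-- `renumCount` with the insertion fold is `renum`. [folklore] -/
theorem renumCount_eq (w : List (ℕ × Bool)) (j : ℕ) : renumCount (touchedListFrom [] (w.map Prod.fst)) j = renum w j := by
  rw [renumCount, renum, rank_eq_length_filter]

/-- **Value of stage 2** on instance data, provided the yardstick `x` is long enough for the `m`
rounds and for the clip. [folklore] -/
theorem dgRenumF_apply (x : List Bool) (D : List ℕ) (w : List (ℕ × Bool)) (hm : w.length ≤ x.length)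
    (hclip : ∀ g ∈ w, (boolPair (encodeNat (renumCount D g.1)) [g.2]).length ≤ x.length + 4) :
    dgRenumF (boolPair x (boolPair (encodeNat w.length) (boolPair (encList (D.map encodeNat)) (encList (w.map letterCode))))) =
      encList (w.map fun g => letterCode (renumCount D g.1, g.2)) := by
  rw [dgRenumF]
  rw [mapLF_apply dgRenumItemC x (encList (D.map encodeNat)) hm (w.map letterCode)]
  rw [List.take_of_length_le (List.length_map letterCode).le]
  rw [List.map_map]
  refine congrArg encList (List.map_congr_left fun g hg => ?_)
  have hc : (boolPair (encodeNat (2 * (D.filter (· < g.1 / 2)).length + g.1 % 2)) [g.2]).length ≤ x.length + 4 := hclip g hg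
  have he : Polynomial.eval x.length (Polynomial.X + 4) = x.length + 4 := by simp
  rw [Function.comp_apply, letterCode, dgRenumItemC, pclipF_apply, fstF_boolPair, dgRenumItemF_apply, he,
    List.take_of_length_le hc]
  rfl

/-! ### Stage 3: the one-hot table of the renumbered letters -/

/-- The one-hot block as a padded window: `(0^i 1 0^A) ↾ A = oneHot A i`. [folklore] -/
theorem take_zeros_one_zeros (A i : ℕ) :
    (List.replicate i false ++ true :: List.replicate A false).take A = oneHot A i := by
  apply List.ext_getElem
  · simp only [List.length_take, List.length_append, List.length_replicate, List.length_cons, length_oneHot]; omega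
  · intro v h1 h2
    rw [length_oneHot] at h2
    rw [List.getElem_take]
    simp only [oneHot, List.getElem_map, List.getElem_range]
    rcases Nat.lt_trichotomy v i with hv | rfl | hv
    · rw [List.getElem_append_left (by simpa using hv)]; simp; omega
    · rw [List.getElem_append_right (by simp)]; simp
    · rw [List.getElem_append_right (by simp; omega)]
      have : v - (List.replicate i false).length = (v - i - 1) + 1 := by simp; omega
      simp only [this, List.getElem_cons_succ, List.getElem_replicate]
      simp; omega

/-- In a table step `⟨⟨⟨UA, R⟩, _⟩, ⟨item, acc⟩⟩`: the yardstick `UA` of length `A`. [folklore] -/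
def dgTabAF : List Bool → List Bool := fstF ∘ fstF ∘ fstF

/-- In a table step: the ruler `R` for unary conversions. [folklore] -/
def dgTabRF : List Bool → List Bool := sndF ∘ fstF ∘ fstF

/-- In a table step: `1^{j'}` for the item `⟨bin j', [σ]⟩`. [folklore] -/
def dgTabUjF : List Bool → List Bool := binToUnaryFn ∘ fanoutFn dgTabRF (fstF ∘ nthF 1)

/-- In a table step: `1^{σ}`. [folklore] -/
def dgTabUsF : List Bool → List Bool := binToUnaryFn ∘ fanoutFn dgTabRF (sndF ∘ nthF 1)

/-- In a table step: a string of length `i = 2j' + σ`. [folklore] -/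
def dgTabUiF : List Bool → List Bool := fun v => dgTabUjF v ++ (dgTabUjF v ++ dgTabUsF v)

/-- In a table step: the block `(0^i 1 0^A) ↾ A`. [cite: AharonovJonesLandau2009, §3.3] -/
def dgTabBlockF : List Bool → List Bool :=
  Plumb.takeFn ∘ fanoutFn dgTabAF (fun v => Kannan.zerosFn (dgTabUiF v) ++ (true :: Kannan.zerosFn (dgTabAF v)))

/-- **The table step**: append the block of the item to the accumulator. [cite: AharonovJonesLandau2009, §3.3] -/
def dgTabStep : List Bool → List Bool := fun v => sndPow 1 v ++ dgTabBlockF v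

/-- `dgTabAF ∈ FP`. [folklore] -/
theorem dgTabAF_mem_FP : dgTabAF ∈ FP := comp_mem_FP fstF_mem_FP (comp_mem_FP fstF_mem_FP fstF_mem_FP)

/-- `dgTabRF ∈ FP`. [folklore] -/
theorem dgTabRF_mem_FP : dgTabRF ∈ FP := comp_mem_FP sndF_mem_FP (comp_mem_FP fstF_mem_FP fstF_mem_FP)

/-- `dgTabUjF ∈ FP`. [folklore] -/
theorem dgTabUjF_mem_FP : dgTabUjF ∈ FP :=
  comp_mem_FP binToUnaryFn_mem_FP (fanoutFn_mem_FP dgTabRF_mem_FP (comp_mem_FP fstF_mem_FP (nthF_mem_FP 1)))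

/-- `dgTabUsF ∈ FP`. [folklore] -/
theorem dgTabUsF_mem_FP : dgTabUsF ∈ FP :=
  comp_mem_FP binToUnaryFn_mem_FP (fanoutFn_mem_FP dgTabRF_mem_FP (comp_mem_FP sndF_mem_FP (nthF_mem_FP 1)))

/-- `dgTabUiF ∈ FP`. [folklore] -/
theorem dgTabUiF_mem_FP : dgTabUiF ∈ FP := append_mem_FP dgTabUjF_mem_FP (append_mem_FP dgTabUjF_mem_FP dgTabUsF_mem_FP)

/-- `dgTabBlockF ∈ FP`. [folklore] -/
theorem dgTabBlockF_mem_FP : dgTabBlockF ∈ FP :=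
  comp_mem_FP Plumb.takeFn_mem_FP (fanoutFn_mem_FP dgTabAF_mem_FP
    (append_mem_FP (comp_mem_FP Kannan.zerosFn_mem_FP dgTabUiF_mem_FP)
      (comp_mem_FP (cons_mem_FP true) (comp_mem_FP Kannan.zerosFn_mem_FP dgTabAF_mem_FP))))

/-- `dgTabStep ∈ FP`. [folklore] -/
theorem dgTabStep_mem_FP : dgTabStep ∈ FP := append_mem_FP (sndPow_mem_FP 1) dgTabBlockF_mem_FP

/-- The block has the length of the yardstick `UA` (at most). [folklore] -/
theorem length_dgTabBlockF_le (v : List Bool) : (dgTabBlockF v).length ≤ (dgTabAF v).length := by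
  simp only [dgTabBlockF, Function.comp_apply, fanoutFn_apply, Plumb.takeFn_boolPair, List.length_take]
  exact min_le_left _ _

/-- **Growth of the table step.** [folklore] -/
theorem foldGrowth_dgTabStep : FoldGrowth 1 dgTabStep := by
  intro v
  have h1 := length_dgTabBlockF_le v
  have h2 : (dgTabAF v).length ≤ (fstF v).length := by
    simp only [dgTabAF, Function.comp_apply]
    have := length_fstF_sndF_le (fstF v); have := length_fstF_sndF_le (fstF (fstF v)); omega
  have hacc : (sndPow 1 v).length = (sndF (sndF v)).length := by simp [sndPow]
  rw [dgTabStep, List.length_append]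
  omega

/-- **Value of the block** for an item `⟨bin j', [σ]⟩` with a ruler at least `max j' 1` long. [cite: AharonovJonesLandau2009, §3.3] -/
theorem dgTabBlockF_apply (UA R rest : List Bool) (j : ℕ) (σ : Bool) (acc : List Bool) (hj : j ≤ R.length) (h1 : 1 ≤ R.length) :
    dgTabBlockF (boolPair (boolPair (boolPair UA R) rest) (boolPair (boolPair (encodeNat j) [σ]) acc)) =
      oneHot UA.length (2 * j + σ.toNat) := by
  have hs : bitsToNat [σ] = σ.toNat := by simp
  have hσ : σ.toNat ≤ R.length := by cases σ <;> simp [h1]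
  have hA : dgTabAF (boolPair (boolPair (boolPair UA R) rest) (boolPair (boolPair (encodeNat j) [σ]) acc)) = UA := by
    simp [dgTabAF]
  have hUj : dgTabUjF (boolPair (boolPair (boolPair UA R) rest) (boolPair (boolPair (encodeNat j) [σ]) acc)) = ones j := by
    simp [dgTabUjF, dgTabRF, min_eq_left hj]
  have hUs : dgTabUsF (boolPair (boolPair (boolPair UA R) rest) (boolPair (boolPair (encodeNat j) [σ]) acc)) = ones σ.toNat := by
    simp [dgTabUsF, dgTabRF, min_eq_left hσ]
  simp only [dgTabBlockF, dgTabUiF, Function.comp_apply, fanoutFn_apply, hA, hUj, hUs, Kannan.zerosFn_apply,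
    Plumb.takeFn_boolPair, List.length_append, List.length_replicate]
  rw [show j + (j + σ.toNat) = 2 * j + σ.toNat by omega, take_zeros_one_zeros]

/-- **Stage 3**: `⟨⟨UA, R⟩, Rc⟩ ↦` the concatenated blocks of the items of `Rc`. [cite: AharonovJonesLandau2009, §3.3] -/
def dgTableF : List Bool → List Bool := foldFn dgTabStep fun _ => []

/-- `dgTableF ∈ FP`. [folklore] -/
theorem dgTableF_mem_FP : dgTableF ∈ FP := foldFn_mem_FP dgTabStep_mem_FP (const_mem_FP _) foldGrowth_dgTabStep

/-- **Value of stage 3** on coded letters with small indices. [cite: AharonovJonesLandau2009, §3.3] -/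
theorem dgTableF_apply (UA R : List Bool) (cw : List (ℕ × Bool)) (hR : ∀ g ∈ cw, g.1 ≤ R.length) (h1 : 1 ≤ R.length) :
    dgTableF (boolPair (boolPair UA R) (encList (cw.map letterCode))) =
      (cw.map fun g => oneHot UA.length (2 * g.1 + g.2.toNat)).flatten := by
  rw [dgTableF, foldFn_boolPair, decNil_encList]
  suffices h : ∀ (l : List (ℕ × Bool)) (acc : List Bool), (∀ g ∈ l, g.1 ≤ R.length) →
      (l.map letterCode).foldl (fun acc a => dgTabStep (boolPair (boolPair (boolPair UA R) (encList (cw.map letterCode))) (boolPair a acc)))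
        acc = acc ++ (l.map fun g => oneHot UA.length (2 * g.1 + g.2.toNat)).flatten by
    simpa using h cw [] hR
  intro l
  induction l with
  | nil => intro acc _; simp
  | cons g l ih =>
    intro acc hl
    rw [List.map_cons, List.foldl_cons, letterCode,
      show dgTabStep (boolPair (boolPair (boolPair UA R) (encList (List.map letterCode cw))) (boolPair (boolPair (encodeNat g.1) [g.2]) acc)) =
        acc ++ oneHot UA.length (2 * g.1 + g.2.toNat) by
        rw [dgTabStep, dgTabBlockF_apply _ _ _ _ _ _ (hl g (by simp)) h1]; simp,
      ih _ fun g' hg' => hl g' (by simp [hg']), List.map_cons, List.flatten_cons, List.append_assoc]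

/-! ### The fields of the instance record and the unary yardsticks -/

/-- The unary letter count `1^m`. [folklore] -/
def dgMUF : List Bool → List Bool := fstF ∘ nthF 1

/-- The coded letter list. [folklore] -/
def dgLettersF : List Bool → List Bool := sndF ∘ nthF 1

/-- The unary precision `1^prec`. [folklore] -/
def dgPrecUF : List Bool → List Bool := sndPow 3

/-- A string of length `2m + 2`. [folklore] -/
def dgM2F : List Bool → List Bool := fun a => dgMUF a ++ (dgMUF a ++ [true, true])

/-- **The size parameter in unary**, of length `t = max (2m + 2) prec`. [cite: AharonovJonesLandau2009, §3.3] -/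
def dgTUF : List Bool → List Bool := iteFn (ltLenF ∘ fanoutFn dgM2F dgPrecUF) dgPrecUF dgM2F

/-- A string of length `A (2t) = 4t - 2`. [folklore] -/
def dgAUF : List Bool → List Bool :=
  Plumb.dropFn ∘ fanoutFn (fun _ => [true, true]) fun a => dgTUF a ++ (dgTUF a ++ (dgTUF a ++ dgTUF a))

/-- A string of length `16 t²` (the digest length; also yardstick and ruler). [folklore] -/
def dgY16F : List Bool → List Bool :=
  UnaryOffsets.mulLenFn ∘ fanoutFn (fun _ => List.replicate 16 true) (UnaryOffsets.mulLenFn ∘ fanoutFn dgTUF dgTUF)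

/-- A string of length `t · A (2t)` (the table length). [folklore] -/
def dgTAUF : List Bool → List Bool := UnaryOffsets.mulLenFn ∘ fanoutFn dgTUF dgAUF

/-- `dgMUF ∈ FP`. [folklore] -/
theorem dgMUF_mem_FP : dgMUF ∈ FP := comp_mem_FP fstF_mem_FP (nthF_mem_FP 1)

/-- `dgLettersF ∈ FP`. [folklore] -/
theorem dgLettersF_mem_FP : dgLettersF ∈ FP := comp_mem_FP sndF_mem_FP (nthF_mem_FP 1)

/-- `dgPrecUF ∈ FP`. [folklore] -/
theorem dgPrecUF_mem_FP : dgPrecUF ∈ FP := sndPow_mem_FP 3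

/-- `dgM2F ∈ FP`. [folklore] -/
theorem dgM2F_mem_FP : dgM2F ∈ FP := append_mem_FP dgMUF_mem_FP (append_mem_FP dgMUF_mem_FP (const_mem_FP _))

/-- `dgTUF ∈ FP`. [folklore] -/
theorem dgTUF_mem_FP : dgTUF ∈ FP :=
  iteFn_mem_FP (comp_mem_FP ltLenF_mem_FP (fanoutFn_mem_FP dgM2F_mem_FP dgPrecUF_mem_FP)) dgPrecUF_mem_FP dgM2F_mem_FP

/-- `dgAUF ∈ FP`. [folklore] -/
theorem dgAUF_mem_FP : dgAUF ∈ FP :=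
  comp_mem_FP Plumb.dropFn_mem_FP (fanoutFn_mem_FP (const_mem_FP _)
    (append_mem_FP dgTUF_mem_FP (append_mem_FP dgTUF_mem_FP (append_mem_FP dgTUF_mem_FP dgTUF_mem_FP))))

/-- `dgY16F ∈ FP`. [folklore] -/
theorem dgY16F_mem_FP : dgY16F ∈ FP :=
  comp_mem_FP UnaryOffsets.mulLenFn_mem_FP (fanoutFn_mem_FP (const_mem_FP _)
    (comp_mem_FP UnaryOffsets.mulLenFn_mem_FP (fanoutFn_mem_FP dgTUF_mem_FP dgTUF_mem_FP)))

/-- `dgTAUF ∈ FP`. [folklore] -/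
theorem dgTAUF_mem_FP : dgTAUF ∈ FP := comp_mem_FP UnaryOffsets.mulLenFn_mem_FP (fanoutFn_mem_FP dgTUF_mem_FP dgAUF_mem_FP)

/-- `|dgTUF a| = max (2|dgMUF a| + 2) |dgPrecUF a|`. [folklore] -/
theorem length_dgTUF (a : List Bool) : (dgTUF a).length = max (2 * (dgMUF a).length + 2) (dgPrecUF a).length := by
  have hc : (ltLenF ∘ fanoutFn dgM2F dgPrecUF) a = [decide ((dgM2F a).length < (dgPrecUF a).length)] := by
    simp only [Function.comp_apply, fanoutFn_apply, ltLenF_boolPair]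
  have h1 : (dgM2F a).length = 2 * (dgMUF a).length + 2 := by
    simp only [dgM2F, List.length_append, List.length_cons, List.length_nil]; omega
  rw [dgTUF, iteFn_apply hc]
  by_cases hlt : (dgM2F a).length < (dgPrecUF a).length
  · rw [decide_eq_true hlt, if_pos rfl]; omega
  · rw [decide_eq_false hlt]; simp only [Bool.false_eq_true, ↓reduceIte]; omega

/-- `|dgAUF a| = 4|dgTUF a| - 2`. [folklore] -/
theorem length_dgAUF (a : List Bool) : (dgAUF a).length = 4 * (dgTUF a).length - 2 := by
  simp only [dgAUF, Function.comp_apply, fanoutFn_apply, Plumb.dropFn_boolPair, List.length_drop, List.length_append,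
    List.length_cons, List.length_nil]
  omega

/-- `|dgY16F a| = 16 |dgTUF a|²`. [folklore] -/
theorem length_dgY16F (a : List Bool) : (dgY16F a).length = 16 * (dgTUF a).length ^ 2 := by
  simp only [dgY16F, Function.comp_apply, fanoutFn_apply, UnaryOffsets.length_mulLenFn, List.length_replicate, pow_two]

/-- `|dgTAUF a| = |dgTUF a| · |dgAUF a|`. [folklore] -/
theorem length_dgTAUF (a : List Bool) : (dgTAUF a).length = (dgTUF a).length * (dgAUF a).length := by
  simp only [dgTAUF, Function.comp_apply, fanoutFn_apply, UnaryOffsets.length_mulLenFn]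

/-! ### The digest function -/

/-- Stage 1 on the instance record. [folklore] -/
def dgDcF : List Bool → List Bool := dgTouchedF ∘ fanoutFn (fun _ => []) dgLettersF

/-- Stage 2 on the instance record. [folklore] -/
def dgRcF : List Bool → List Bool :=
  dgRenumF ∘ fanoutFn dgY16F (fanoutFn (lenBinF ∘ dgMUF) (fanoutFn dgDcF dgLettersF))

/-- Stage 3 on the instance record: the blocks of the letters. [folklore] -/
def dgTabLettersF : List Bool → List Bool := dgTableF ∘ fanoutFn (fanoutFn dgAUF dgY16F) dgRcF

/-- The table field: the letter blocks padded with zeros to `t · A` bits. [cite: AharonovJonesLandau2009, §3.3] -/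
def dgTabF : List Bool → List Bool :=
  Plumb.takeFn ∘ fanoutFn dgTAUF fun a => dgTabLettersF a ++ Kannan.zerosFn (dgY16F a)

/-- The repeated vertex codes `(0001)^t`. [cite: AharonovJonesLandau2009, §3.3] -/
def dgPatCoreF : List Bool → List Bool := UnaryOffsets.mulLenFn ∘ fanoutFn dgTUF fun _ => [false, false, false, true]

/-- The pattern field `(0001)^t 00`. [cite: AharonovJonesLandau2009, §3.3] -/
def dgPatF : List Bool → List Bool := fun a => dgPatCoreF a ++ [false, false]

/-- **The digest function**: table, pattern, zero padding to `16 t²` bits. [cite: AharonovJonesLandau2009, §3.3] -/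
def dgDigestF : List Bool → List Bool :=
  Plumb.takeFn ∘ fanoutFn dgY16F fun a => dgTabF a ++ (dgPatF a ++ Kannan.zerosFn (dgY16F a))

/-- `dgDcF ∈ FP`. [folklore] -/
theorem dgDcF_mem_FP : dgDcF ∈ FP := comp_mem_FP dgTouchedF_mem_FP (fanoutFn_mem_FP (const_mem_FP _) dgLettersF_mem_FP)

/-- `dgRcF ∈ FP`. [folklore] -/
theorem dgRcF_mem_FP : dgRcF ∈ FP :=
  comp_mem_FP dgRenumF_mem_FP (fanoutFn_mem_FP dgY16F_mem_FP (fanoutFn_mem_FP (comp_mem_FP lenBinF_mem_FP dgMUF_mem_FP)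
    (fanoutFn_mem_FP dgDcF_mem_FP dgLettersF_mem_FP)))

/-- `dgTabLettersF ∈ FP`. [folklore] -/
theorem dgTabLettersF_mem_FP : dgTabLettersF ∈ FP :=
  comp_mem_FP dgTableF_mem_FP (fanoutFn_mem_FP (fanoutFn_mem_FP dgAUF_mem_FP dgY16F_mem_FP) dgRcF_mem_FP)

/-- `dgTabF ∈ FP`. [folklore] -/
theorem dgTabF_mem_FP : dgTabF ∈ FP :=
  comp_mem_FP Plumb.takeFn_mem_FP (fanoutFn_mem_FP dgTAUF_mem_FP
    (append_mem_FP dgTabLettersF_mem_FP (comp_mem_FP Kannan.zerosFn_mem_FP dgY16F_mem_FP)))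

/-- `dgPatF ∈ FP`. [folklore] -/
theorem dgPatF_mem_FP : dgPatF ∈ FP :=
  append_mem_FP (comp_mem_FP UnaryOffsets.mulLenFn_mem_FP (fanoutFn_mem_FP dgTUF_mem_FP (const_mem_FP _)) : dgPatCoreF ∈ FP)
    (const_mem_FP _)

/-- **The digest function is polynomial-time.** [cite: AharonovJonesLandau2009, Thm. 1.2 ("classical polynomial pre-processing")] [cite: AroraBarak2009, §1.3] -/
theorem dgDigestF_mem_FP : dgDigestF ∈ FP :=
  comp_mem_FP Plumb.takeFn_mem_FP (fanoutFn_mem_FP dgY16F_mem_FP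
    (append_mem_FP dgTabF_mem_FP (append_mem_FP dgPatF_mem_FP (comp_mem_FP Kannan.zerosFn_mem_FP dgY16F_mem_FP))))

/-! ### List identities for the assembly -/

/-- The coded list of an encoded letter list. [folklore] -/
theorem foldr_boolPair_eq_encList (l : List (ℕ × Bool)) :
    l.foldr (fun a acc => boolPair ((encodingNatBool.pairBool encodingBoolBool).encode a) acc) [] = encList (l.map letterCode) := by
  induction l with
  | nil => rfl
  | cons g l ih => rw [List.foldr_cons, ih, List.map_cons, encList_cons]; rfl

/-- `(0001)^t 00 = patList t`. [folklore] -/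
theorem flatten_replicate_eq_patList (t : ℕ) :
    (List.replicate t [false, false, false, true]).flatten ++ [false, false] = patList t := by
  induction t with
  | zero => simp [patList, List.range_succ]
  | succ t ih =>
    have e : 2 * (2 * (t + 1) + 1) = 4 + 2 * (2 * t + 1) := by ring
    have h4 : (List.range 4).map (fun w => decide (w % 4 = 3)) = [false, false, false, true] := by simp [List.range_succ]
    have hc : ((fun w => decide (w % 4 = 3)) ∘ fun w => 4 + w) = fun w => decide (w % 4 = 3) := by
      funext w
      have hw : (4 + w) % 4 = w % 4 := by omega
      simp only [Function.comp_apply, hw]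
    rw [List.replicate_succ, List.flatten_cons, List.append_assoc, ih]
    unfold patList
    rw [e, List.range_add, List.map_append, List.map_map, h4, hc]

/-- A concatenation of `k` zero blocks of length `A`. [folklore] -/
theorem flatten_replicate_replicate (k A : ℕ) :
    (List.replicate k (List.replicate A false)).flatten = List.replicate (k * A) false := by
  induction k with
  | zero => simp
  | succ k ih => rw [List.replicate_succ, List.flatten_cons, ih, ← List.replicate_add]; congr 1; ring

/-- The length of a concatenation of blocks of equal length. [folklore] -/
theorem length_flatten_of_forall {A : ℕ} : ∀ (L : List (List Bool)), (∀ b ∈ L, b.length = A) → L.flatten.length = L.length * A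
  | [], _ => by simp
  | b :: L, h => by
    rw [List.flatten_cons, List.length_append, h b (by simp), length_flatten_of_forall L fun b' hb' => h b' (by simp [hb']),
      List.length_cons]
    ring

/-- `take` past the first list of an append. [folklore] -/
theorem take_append_of_ge {l₁ l₂ : List Bool} {n : ℕ} (h : l₁.length ≤ n) :
    (l₁ ++ l₂).take n = l₁ ++ l₂.take (n - l₁.length) := by
  conv_lhs => rw [show n = l₁.length + (n - l₁.length) by omega]
  rw [List.take_length_add_append]

/-- The slot blocks of a word occupying the first `m ≤ t` slots: letter blocks, then zero blocks.
[folklore] -/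
theorem tabList_eq_append (t A' : ℕ) (cw : List (ℕ × Bool)) (hm : cw.length ≤ t) (hA : A (2 * t) = A') :
    tabList t cw = (cw.map fun g => oneHot A' (2 * g.1 + g.2.toNat)).flatten ++ List.replicate ((t - cw.length) * A') false := by
  unfold tabList
  rw [hA]
  obtain ⟨k, rfl⟩ : ∃ k, t = cw.length + k := ⟨t - cw.length, by omega⟩
  rw [List.range_add, List.map_append, List.flatten_append, Nat.add_sub_cancel_left]
  have hL : (List.range cw.length).map (fun s => slotBlock A' cw[s]?) = cw.map fun g => oneHot A' (2 * g.1 + g.2.toNat) := by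
    apply List.ext_getElem
    · simp
    · intro s h1 h2
      rw [List.length_map, List.length_range] at h1
      rw [List.getElem_map, List.getElem_range, List.getElem_map, List.getElem?_eq_getElem h1]
      rfl
  have hR : ((List.range k).map fun x => cw.length + x).map (fun s => slotBlock A' cw[s]?) = List.replicate k (List.replicate A' false) := by
    rw [List.map_map]
    have : ((fun s => slotBlock A' cw[s]?) ∘ fun x => cw.length + x) = fun _ => List.replicate A' false := by
      funext s
      simp only [Function.comp_apply]
      rw [List.getElem?_eq_none (by omega)]; rfl
    rw [this, List.map_const', List.length_range]
  rw [hL, hR, flatten_replicate_replicate]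

/-- The letters of the closed-form compression are the renumbered letters. [folklore] -/
theorem compressCF_snd (w : List (ℕ × Bool)) : (compressCF w).2 = w.map fun g => (renum w g.1, g.2) := by
  unfold compressCF; split_ifs with h
  · subst h; rfl
  · rfl

/-- `renum w j ≤ 4|w| + 1`. [folklore] -/
theorem renum_le (w : List (ℕ × Bool)) (j : ℕ) : renum w j ≤ 4 * w.length + 1 := by
  unfold renum rank
  have h1 : ((touched w).filter (· < j / 2)).card ≤ (touched w).card := Finset.card_filter_le _ _
  have h2 := card_touched_le w
  omega

/-! ### The digest function on encodings of valid instances -/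

section Encodings

variable (x : RawJonesInstance)

/-- The fields read off `encode x`. [folklore] -/
theorem dgFields_encode :
    dgMUF (RawJonesInstance.encoding.encode x) = unaryEncodeNat x.2.1.length ∧
    dgLettersF (RawJonesInstance.encoding.encode x) = encList (x.2.1.map letterCode) ∧
    dgPrecUF (RawJonesInstance.encoding.encode x) = unaryEncodeNat x.prec := by
  obtain ⟨n, wd, θn, θd, prec⟩ := x
  refine ⟨?_, ?_, ?_⟩
  · simp [dgMUF, RawJonesInstance.encoding, Encoding.pairBool, Encoding.listBool]
  · simp only [dgLettersF, RawJonesInstance.encoding, Encoding.pairBool, Encoding.listBool, Function.comp_apply,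
      nthF_succ_boolPair, nthF_zero_boolPair, sndF_boolPair]
    exact foldr_boolPair_eq_encList wd
  · simp [dgPrecUF, RawJonesInstance.encoding, Encoding.pairBool, Encoding.listBool, RawJonesInstance.prec, unaryEncodingNat]

/-- `|dgTUF (encode x)| = tI x`. [folklore] -/
theorem length_dgTUF_encode : (dgTUF (RawJonesInstance.encoding.encode x)).length = tI x := by
  obtain ⟨h1, -, h3⟩ := dgFields_encode x
  rw [length_dgTUF, h1, h3, tI]
  have e1 : (unaryEncodeNat x.2.1.length).length = x.2.1.length := unary_decode_encode_nat _
  have e2 : (unaryEncodeNat x.prec).length = x.prec := unary_decode_encode_nat _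
  rw [e1, e2]; omega

/-- `|dgAUF (encode x)| = A (2 tI x)`. [folklore] -/
theorem length_dgAUF_encode : (dgAUF (RawJonesInstance.encoding.encode x)).length = A (2 * tI x) := by
  rw [length_dgAUF, length_dgTUF_encode, A]; omega

/-- `|dgY16F (encode x)| = 16 (tI x)²`. [folklore] -/
theorem length_dgY16F_encode : (dgY16F (RawJonesInstance.encoding.encode x)).length = 16 * tI x ^ 2 := by
  rw [length_dgY16F, length_dgTUF_encode]

/-- Stage 1 on `encode x`. [folklore] -/
theorem dgDcF_encode :
    dgDcF (RawJonesInstance.encoding.encode x) = encList ((touchedListFrom [] (x.2.1.map Prod.fst)).map encodeNat) := by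
  obtain ⟨-, h2, -⟩ := dgFields_encode x
  rw [dgDcF, Function.comp_apply, fanoutFn_apply, h2, dgTouchedF_apply]

/-- Stage 2 on `encode x`: the coded renumbered letters. [folklore] -/
theorem dgRcF_encode :
    dgRcF (RawJonesInstance.encoding.encode x) = encList (x.2.1.map fun g => letterCode (renum x.2.1 g.1, g.2)) := by
  obtain ⟨h1, h2, -⟩ := dgFields_encode x
  have ht := one_le_tI x
  have hm : x.2.1.length ≤ tI x := by unfold tI; omega
  have e1 : (unaryEncodeNat x.2.1.length).length = x.2.1.length := unary_decode_encode_nat _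
  rw [dgRcF, Function.comp_apply, fanoutFn_apply, fanoutFn_apply, fanoutFn_apply, Function.comp_apply, h1, lenBinF_apply, e1,
    dgDcF_encode, h2, dgRenumF_apply]
  · simp only [renumCount_eq]
  · rw [length_dgY16F_encode]; nlinarith
  · intro g hg
    rw [renumCount_eq, length_boolPair, length_dgY16F_encode, List.length_singleton]
    have h3 := length_encodeNat_le_self (renum x.2.1 g.1)
    have h4 := renum_le x.2.1 g.1
    nlinarith

/-- The letter blocks on `encode x`. [cite: AharonovJonesLandau2009, §3.3] -/
theorem dgTabLettersF_encode :
    dgTabLettersF (RawJonesInstance.encoding.encode x) =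
      ((x.2.1.map fun g => (renum x.2.1 g.1, g.2)).map fun g => oneHot (A (2 * tI x)) (2 * g.1 + g.2.toNat)).flatten := by
  have ht := one_le_tI x
  rw [dgTabLettersF, Function.comp_apply, fanoutFn_apply, fanoutFn_apply, dgRcF_encode,
    show (x.2.1.map fun g => letterCode (renum x.2.1 g.1, g.2)) = (x.2.1.map fun g => (renum x.2.1 g.1, g.2)).map letterCode by
      rw [List.map_map]; rfl,
    dgTableF_apply, length_dgAUF_encode]
  · intro g hg
    rw [List.mem_map] at hg
    obtain ⟨g', hg', rfl⟩ := hg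
    rw [length_dgY16F_encode]
    have h4 := renum_le x.2.1 g'.1
    have hm : x.2.1.length ≤ tI x := by unfold tI; omega
    nlinarith
  · rw [length_dgY16F_encode]; nlinarith

/-- `t · A (2t) + 2(2t + 1) ≤ 16 t²`: everything fits into the digest. [folklore] -/
theorem fields_fit (t : ℕ) (ht : 1 ≤ t) : t * A (2 * t) + 2 * (2 * t + 1) ≤ 16 * t ^ 2 := by
  obtain ⟨s, hs, hs'⟩ : ∃ s, A (2 * t) = s ∧ s + 2 = 4 * t := ⟨_, rfl, by unfold A; omega⟩
  rw [hs]; nlinarith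

/-- The table field on `encode x` (valid `x`). [cite: AharonovJonesLandau2009, §3.3] -/
theorem dgTabF_encode (hx : x.IsValid) : dgTabF (RawJonesInstance.encoding.encode x) = tabList (tI x) (cword x).2 := by
  have ht := one_le_tI x
  have hm : x.2.1.length ≤ tI x := by unfold tI; omega
  have hcw : (cword x).2 = x.2.1.map fun g => (renum x.2.1 g.1, g.2) := by
    rw [cword, compressRaw_instance_eq x hx, compressCF_snd]
  have hlen : ((x.2.1.map fun g => (renum x.2.1 g.1, g.2)).map fun g => oneHot (A (2 * tI x)) (2 * g.1 + g.2.toNat)).flatten.length =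
      x.2.1.length * A (2 * tI x) := by
    rw [length_flatten_of_forall _ fun b hb => by
      rw [List.mem_map] at hb; obtain ⟨g, -, rfl⟩ := hb; exact length_oneHot _ _]
    rw [List.length_map, List.length_map]
  have hfit : x.2.1.length * A (2 * tI x) ≤ tI x * A (2 * tI x) := Nat.mul_le_mul_right _ hm
  have h16 : tI x * A (2 * tI x) ≤ 16 * tI x ^ 2 := le_trans (Nat.le_add_right _ _) (fields_fit (tI x) ht)
  rw [dgTabF, Function.comp_apply, fanoutFn_apply, Plumb.takeFn_boolPair, dgTabLettersF_encode, Kannan.zerosFn_apply,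
    length_dgTAUF, length_dgTUF_encode, length_dgAUF_encode, length_dgY16F_encode, hcw,
    tabList_eq_append (tI x) (A (2 * tI x)) _ (by rw [List.length_map]; exact hm) rfl, List.length_map,
    take_append_of_ge (by rw [hlen]; exact hfit), hlen, List.take_replicate]
  congr 2
  rw [min_eq_left (by omega), Nat.sub_mul]

/-- The pattern field on `encode x`. [cite: AharonovJonesLandau2009, §3.3] -/
theorem dgPatF_encode : dgPatF (RawJonesInstance.encoding.encode x) = patList (tI x) := by
  rw [dgPatF, dgPatCoreF, Function.comp_apply, fanoutFn_apply, UnaryOffsets.mulLenFn_boolPair, length_dgTUF_encode,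
    flatten_replicate_eq_patList]

/-- **The digest function agrees with the digest on the encodings of valid instances.**
[cite: AharonovJonesLandau2009, §3.3] -/
theorem dgDigestF_encode (hx : x.IsValid) :
    dgDigestF (RawJonesInstance.encoding.encode x) = digest (RawJonesInstance.encoding.encode x) := by
  have ht := one_le_tI x
  have hfit := fields_fit (tI x) ht
  rw [dgDigestF, Function.comp_apply, fanoutFn_apply, Plumb.takeFn_boolPair, dgTabF_encode x hx, dgPatF_encode,
    Kannan.zerosFn_apply, length_dgY16F_encode, digest_encode_eq_blocks,
    take_append_of_ge (by rw [length_tabList]; omega), length_tabList,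
    take_append_of_ge (by rw [length_patList]; omega), length_patList,
    List.take_replicate, List.append_assoc,
    min_eq_left (show 16 * tI x ^ 2 - tI x * A (2 * tI x) - 2 * (2 * tI x + 1) ≤ 16 * tI x ^ 2 by omega)]

end Encodings

/-! ### Assembly -/

/-- **The AJL problem is in `PromiseBQP` given only the uniformity of the core family**: the digest
and the post-processor of `JonesPost.mem_PromiseBQP_of_FP` are discharged by `dgDigestF` and
`ajlPostF`. [cite: AharonovJonesLandau2009, Thm. 1.2] -/
theorem mem_PromiseBQP_of_uniform (hU : family.IsUniform) : ajl_jonesApproxProblem_mem_PromiseBQP :=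
  mem_PromiseBQP_of_uniform_of_digest' hU dgDigestF_mem_FP fun x hx => dgDigestF_encode x hx

end AJLCore

/-- **AJL in AJL's own gate set, given the uniformity of the core family**: the named fact
`ajl_mem_PromiseBQPOver_ajlGateSet` (`JonesInBQPProofs.lean`) follows from the uniformity of
`AJLCore.family` by `mem_PromiseBQP_of_uniform` and the gate-set transport
`ajl_mem_PromiseBQPOver_ajlGateSet_of_mem_PromiseBQP` (`PromiseBQPOverTransport.lean`).
[cite: AharonovJonesLandau2009, Thm. 1.2 and §3.3] -/
theorem ajl_mem_PromiseBQPOver_ajlGateSet_of_uniform (hU : AJLCore.family.IsUniform) : ajl_mem_PromiseBQPOver_ajlGateSet :=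
  ajl_mem_PromiseBQPOver_ajlGateSet_of_mem_PromiseBQP (AJLCore.mem_PromiseBQP_of_uniform hU)

end Literature.Computability.QuantumComplexity

end
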